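import Summits.BirchSwinnertonDyer.BirchSwinnertonDyer.Theorems.ByReductionTypeAtTwoAdditivePotGoodLowerHalfT0ClassLiftC
import Summits.BirchSwinnertonDyer.BirchSwinnertonDyer.Theorems.ByReductionTypeAtTwoAdditivePotGoodLowerHalfT0ClassLiftG
import Summits.BirchSwinnertonDyer.BirchSwinnertonDyer.Theorems.ByReductionTypeAtTwoFineSelmerConjAAtTwoAdditivePotGoodFukudaRowStampsF
import Summits.BirchSwinnertonDyer.BirchSwinnertonDyer.Theorems.ByReductionTypeAtTwoFineSelmerConjAAtTwoAdditivePotGoodOddDiscriminantDoor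
import Summits.BirchSwinnertonDyer.BirchSwinnertonDyer.Theorems.ByReductionTypeAtTwoOrdKatoHalfAtTwoIsoConjATwoCubicModelOfClassicalMu
import Literature.NumberTheory.IwasawaTheory.Fukuda1994Thm1RankProofs
import HarnessLib

/-!
# K4 crux `AdditiveRankZeroAtTwo` (19098), child C3″ `AdditivePotGoodLowerHalfAtTwo` (item 22617): the two Fukuda RANK-FORM rows `200160bb1`, `306936ce1`
# (`Δ_cubic < 0`, even class number) — statement (A) at `2` and the BSD₂ rungs WITHOUT the Lim fact, modulo ONE displayed rank equality
# (seat `bsd-2adic-k4-w2` GEN 10; `--supports stmt-BirchSwinnertonDyer-22617 --as helper`)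

Cell `bsd-2adic`. k4-w1's stamps `AddKatoTwo.conjA_two_<L>_of_fukudaLayers hLim2 hθ h01` (p692752 `…FukudaRowStampsF`, GEN 6 `…OddDiscriminantDoor`) derive
(A)₂ on these two rows from the PRINT binder `hLim2` (Lim 2017 Thm. 3.5 at `2` downstairs at the real cubic carrier — D-audit risk `LIM35@2-REAL`) and ONE
displayed instrument equality `h01 : rank₂ Cl(layer 1) = rank₂ Cl(layer 0)` of every cyclotomic `ℤ₂`-tower of the cubic point field `ℚ(θ)` (Fukuda's
index `n₀ = 0` being kernel). Since cruxlead-19573-w2 GEN 7's KERNEL `ℓ = 2` ascent (`TotallyComplexMu.conjA_two_cubicModel_of_classicalMu_of_discr_neg`,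
p728213: `μ₂(ℚ(β)_cyc) = 0` + `Δ_cubic < 0` ⟹ (A)₂, no Lim fact) the Lim binder is unnecessary on every `Δ_cubic < 0` row: §1 re-proves the two stamps
with the last step replaced (Fukuda 1994 Thm. 1 (2) `_holds` turns `h01` + total ramification into `μ₂ = 0`; then the ascent door) —
`AddKatoTwo.conjA_two_<L>_of_rankEq hθ h01` (hLim2 GONE); §2 re-keys GEN 3's rungs: `AddPotGoodInstances.bsdp_two_<L>_rankEq`,
`bsdp_two_of_isIsogenous_<L>_rankEq` — BSD₂ on the class ⟸ PRINT {hSharp (reading), hGZK, hmod, hCT(, hCassels)} + RECORD {r_an = 0, #Ш_an = q, ord₂ q ≤ 6}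
+ the two VALUED Selmer slots + `h01` (instrument tier, census `cyc3/cyc6` ranks) — compared with GEN 8's `…_of_lim2_layers` rungs (p718190) `hLim2` is GONE.
With this file NO `Δ_cubic < 0` row of the 44-row t = 0 S₃ census carries a Lim binder any more (the 7 remaining `hLim2` rows are all `Δ_cubic > 0`).

HONEST FRAMING (D-0036 / D-0054 / D-0152): conditional theorems; `h01` is a numeric (PARI/census) input not certified in the kernel (degree-6 class-group
2-rank); `hSharp` is the Kato-at-`2` SHARP reading (D-audit PASS). Closes nothing at the `∀`-level (C3″ 22617 / C1″ 22615 OPEN); nothing booked (D-0054);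
no rung moves; BSD is not proved by any of this. THEOREMS ONLY (no `def`). §1 is an ADAPTED COPY of k4-w1's two proofs (model change `θ ↔ β`, integral
element `B`, index-`0` certificates verbatim); only the final combinator differs.

References: [Fukuda1994] Thm. 1 (2), p. 264; [Iwasawa1973MuInvariants] Thm. 2/3; [CoatesSujatha2005] (A), Thm. 3.4; [Lim2017FineSelmer] §3 (guarded kernel
form, w2 p723148); [Kato2004Asterisque] Thm. 12.5 (1)(3), 13.8, 14.14; [Cassels1965ArithmeticVIII] Thm. 1.3; [Washington1997] §13.1 Lemma 13.3; [Miller2011LMS] Def. 1.1.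
-/

set_option autoImplicit false
-- the Theorems namespace of this sub repeats the summit name by design (D-0017 nested layout)
set_option linter.dupNamespace false

noncomputable section

open scoped Classical IntermediateField NumberField Real nonZeroDivisors

/-! ## §1 The two stamps without the Lim fact (namespace `AddKatoTwo`, next to k4-w1's `_of_fukudaLayers` originals) -/

namespace Summit.BirchSwinnertonDyer.BirchSwinnertonDyer.Theorems.AddKatoTwo

open WeierstrassCurve Field Polynomial IsDedekindDomain NumberField Matrix Literature.NumberTheory.EllipticCurves
  Literature.NumberTheory.GaloisRepresentations
  Literature.NumberTheory.IwasawaTheory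
  Summit.BirchSwinnertonDyer.BirchSwinnertonDyer.Theorems.SteinbergFibreAtTwo
  Summit.BirchSwinnertonDyer.BirchSwinnertonDyer.Theorems.AlignedTransportAtTwoTorsionPointField
  Summit.BirchSwinnertonDyer.BirchSwinnertonDyer.Theses.ByReductionTypeAtTwo

/-- **A monic integer cubic with a root `β` of degree `3` is irreducible** (`[ℚ(β) : ℚ] = 3` ⟹ the cubic is the minimal polynomial of `β`).
(Same statement as k4-w1's `irreducible_cubic_of_finrank_adjoin_eq_three` in `…AscentStampsA`, restated to keep this file off that import.) [folklore] -/
private theorem irreducible_cubic_of_finrank_adjoin_eq_three'' {p q r : ℤ} {β : AlgebraicClosure ℚ}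
    (hβ : aeval β (Cubic.toPoly ⟨1, (p : ℚ), q, r⟩) = 0) (h3 : Module.finrank ℚ (IntermediateField.adjoin ℚ {β}) = 3) :
    Irreducible (Cubic.toPoly ⟨1, (p : ℚ), q, r⟩) := by
  have hfm : (Cubic.toPoly ⟨1, (p : ℚ), q, r⟩).Monic := Cubic.monic_of_a_eq_one'
  have hβint : IsIntegral ℚ β := ⟨_, hfm, by rwa [← aeval_def]⟩
  have hdeg : (minpoly ℚ β).natDegree = (Cubic.toPoly ⟨1, (p : ℚ), q, r⟩).natDegree := by
    rw [← IntermediateField.adjoin.finrank hβint, h3, Cubic.natDegree_of_a_ne_zero' one_ne_zero]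
  have heq : Cubic.toPoly ⟨1, (p : ℚ), q, r⟩ = minpoly ℚ β :=
    Polynomial.eq_of_monic_of_dvd_of_natDegree_le (minpoly.monic hβint) hfm (minpoly.dvd ℚ β hβ) hdeg.ge
  rw [heq]
  exact minpoly.irreducible hβint

/-- **(A)₂ for `200160bb1` WITHOUT the Lim fact — ONE displayed instrument equality** (Fukuda RANK-FORM row; `2`-torsion cubic field `ℚ(θ)`,
`θ³ + (-2)θ² + (-29)θ + (-120) = 0`, `d = -16680 < 0`, EVEN class number). Displayed: `rank₂ Cl(ℚ(θ)·ℚ₁) = rank₂ Cl(ℚ(θ))` along every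
cyclotomic `ℤ₂`-tower (`h01`, census/PARI). KERNEL: total ramification from layer `0` by k4-w1's EVEN-INDEX certificate (`2 = 𝔭²𝔮`-type index-`0` discharge, k4-w1 GEN 5 `…FukudaRowStampsF`), Fukuda 1994 Thm. 1 (2)
(`classicalMuVanishes_of_classGroupPRank_succ_eq'`, tree `_holds`) ⟹ `μ₂(ℚ(θ)_cyc) = 0` ⟹ cruxlead-19573-w2's `ℓ = 2` ascent to the totally complex `ℚ(E[2])`
and guarded kernel Lim 3.5@2 (`TotallyComplexMu.conjA_two_cubicModel_of_classicalMu_of_discr_neg`, p728213). k4-w1's `conjA_two_200160bb1_of_fukudaLayers`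
proof word for word (adapted copy) with the last step replaced; the binder `hLim2` is GONE. BSD for `200160bb1` is NOT proved by this.
[cite: CoatesSujatha2005, Conj. A and Thm. 3.4] [cite: Fukuda1994, Thm. 1 (2), p. 264] [cite: Iwasawa1973MuInvariants, Thm. 2 and Thm. 3] -/
-- adapted from k4-w1's `conjA_two_200160bb1_of_fukudaLayers` (hLim2 door ↦ Fukuda `_holds` + w2's ascent door)
theorem conjA_two_200160bb1_of_rankEq
    {θ : AlgebraicClosure ℚ} (hθ : aeval θ (Cubic.toPoly ⟨1, ((-2 : ℤ) : ℚ), ((-29 : ℤ) : ℚ), ((-120 : ℤ) : ℚ)⟩) = 0)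
    (h01 : haveI : FiniteDimensional ℚ (IntermediateField.adjoin ℚ {θ}) :=
        IntermediateField.adjoin.finiteDimensional ((AlgebraicClosure.isAlgebraic ℚ).isAlgebraic θ).isIntegral
      haveI : NumberField (IntermediateField.adjoin ℚ {θ}) := NumberField.mk
      ∀ κL : ZpExtension (IntermediateField.adjoin ℚ {θ}) 2, κL.IsCyclotomic → classGroupPRank κL 1 = classGroupPRank κL 0)
    (κ : ZpExtension ℚ 2) (hκ : κ.IsCyclotomic) :
    haveI := isElliptic_200160bb1'
    ∃ (γ : absoluteGaloisGroup ℚ) (D : (⟨0, ((0 : ℤ) : ℚ), 0, ((-1046032063923 : ℤ) : ℚ), ((411780464906411878 : ℤ) : ℚ)⟩ : WeierstrassCurve ℚ).FineSelmerDualData κ γ),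
      Module.Finite ℤ_[2] (RestrictScalars ℤ_[2] (IwasawaAlgebra 2) D.X) := by
  haveI := isElliptic_200160bb1'
  have hθ' : θ ^ 3 + (-2 : AlgebraicClosure ℚ) * θ ^ 2 + (-29 : AlgebraicClosure ℚ) * θ + (-120 : AlgebraicClosure ℚ) = 0 := by
    have := hθ
    simp only [Cubic.toPoly, map_one, one_mul, aeval_add, aeval_mul, aeval_C, aeval_X_pow, aeval_X,
      eq_ratCast, Rat.cast_intCast] at this
    push_cast at this
    linear_combination this
  set β : AlgebraicClosure ℚ := algebraMap ℚ (AlgebraicClosure ℚ) (361562 : ℚ) +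
      algebraMap ℚ (AlgebraicClosure ℚ) (-84876 : ℚ) * θ + algebraMap ℚ (AlgebraicClosure ℚ) (-14757 : ℚ) * θ ^ 2 with hβdef
  have hβ : aeval β (Cubic.toPoly ⟨1, ((0 : ℤ) : ℚ), ((-1046032063923 : ℤ) : ℚ), ((411780464906411878 : ℤ) : ℚ)⟩) = 0 := by
    simp only [Cubic.toPoly, map_one, one_mul, aeval_add, aeval_mul, aeval_C, aeval_X_pow, aeval_X, eq_ratCast,
      Rat.cast_intCast]
    rw [hβdef]
    simp only [eq_ratCast]
    push_cast
    linear_combination ((-673674702107004 : AlgebraicClosure ℚ) + (-299663968415895 : AlgebraicClosure ℚ) * θ + (-61877333120958 : AlgebraicClosure ℚ) * θ ^ 2 + (-3213617856093 : AlgebraicClosure ℚ) * θ ^ 3) * hθ'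
  have hadj : IntermediateField.adjoin ℚ {β} = IntermediateField.adjoin ℚ {θ} := by
    apply le_antisymm
    · rw [IntermediateField.adjoin_simple_le_iff, hβdef]
      have hθmem := IntermediateField.mem_adjoin_simple_self ℚ θ
      exact add_mem (add_mem (algebraMap_mem _ _) (mul_mem (algebraMap_mem _ _) hθmem))
        (mul_mem (algebraMap_mem _ _) (pow_mem hθmem 2))
    · rw [IntermediateField.adjoin_simple_le_iff]
      have hθeq : θ = algebraMap ℚ (AlgebraicClosure ℚ) (1715429128911329/427832148375 : ℚ) +
          algebraMap ℚ (AlgebraicClosure ℚ) (-2909744551/855664296750 : ℚ) * β +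
          algebraMap ℚ (AlgebraicClosure ℚ) (-4919/855664296750 : ℚ) * β ^ 2 := by
        rw [hβdef]; simp only [eq_ratCast]; push_cast
        linear_combination (((803591987371 : AlgebraicClosure ℚ) / 47536905375) + ((119022883559 : AlgebraicClosure ℚ) / 95073810750) * θ) * hθ'
      rw [hθeq]
      have hβmem := IntermediateField.mem_adjoin_simple_self ℚ β
      exact add_mem (add_mem (algebraMap_mem _ _) (mul_mem (algebraMap_mem _ _) hβmem))
        (mul_mem (algebraMap_mem _ _) (pow_mem hβmem 2))
  have hirr := irreducible_cubic_d16680n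
  haveI : FiniteDimensional ℚ (IntermediateField.adjoin ℚ {θ}) :=
    IntermediateField.adjoin.finiteDimensional ((AlgebraicClosure.isAlgebraic ℚ).isAlgebraic θ).isIntegral
  haveI : NumberField (IntermediateField.adjoin ℚ {θ}) := NumberField.mk
  obtain ⟨B, -, hB⟩ := exists_ringOfIntegers_cubic_root (p := -2) (q := -29) (r := -120) hθ
  have h3 := finrank_adjoin_eq_three_of_irreducible hirr hθ
  have hz : (2 : 𝓞 (IntermediateField.adjoin ℚ {θ})) - (((80640 : ℤ) : 𝓞 (IntermediateField.adjoin ℚ {θ})) + ((29688 : ℤ) : 𝓞 (IntermediateField.adjoin ℚ {θ})) * B + ((5219 : ℤ) : 𝓞 (IntermediateField.adjoin ℚ {θ})) * B ^ 2) ^ 3 =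
      ((-31322721666628318 : ℤ) : 𝓞 (IntermediateField.adjoin ℚ {θ})) + (-11613947827985404 : ℤ) * B + (-2021601237788599 : ℤ) * B ^ 2 := by
    push_cast; linear_combination (((-256652792504036 : ℤ) : 𝓞 (IntermediateField.adjoin ℚ {θ})) + ((-29932088426283 : ℤ) : 𝓞 (IntermediateField.adjoin ℚ {θ})) * B + ((-2710231595422 : ℤ) : 𝓞 (IntermediateField.adjoin ℚ {θ})) * B ^ 2 + ((-142154918459 : ℤ) : 𝓞 (IntermediateField.adjoin ℚ {θ})) * B ^ 3) * hB
  have hN : ¬ (8 : ℤ) ∣ Algebra.norm ℤ ((2 : 𝓞 (IntermediateField.adjoin ℚ {θ})) - (((80640 : ℤ) : 𝓞 (IntermediateField.adjoin ℚ {θ})) + ((29688 : ℤ) : 𝓞 (IntermediateField.adjoin ℚ {θ})) * B + ((5219 : ℤ) : 𝓞 (IntermediateField.adjoin ℚ {θ})) * B ^ 2) ^ 3) := by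
    rw [hz]
    exact not_eight_dvd_norm_coords _ h3 B hirr hB (-31322721666628318) (-11613947827985404) (-2021601237788599) (N := -255853312694546481414473091513903198)
      (by simp only [Matrix.one_fin_three, Matrix.det_fin_three, Matrix.add_apply, Matrix.smul_apply, sq, Matrix.mul_apply,
        Fin.sum_univ_three, Matrix.of_apply, Matrix.cons_val', Matrix.cons_val_zero, Matrix.cons_val_one, Matrix.cons_val_two,
        Matrix.head_cons, Matrix.tail_cons, Matrix.empty_val', Matrix.cons_val_fin_one, smul_eq_mul]; norm_num) (by norm_num)
  have htot := forall_totallyRamifiedFrom_zero_adjoin_of_evenIndexCertificate (p := -2) (q := -29) (r := -120) hirr hθ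
      (((0 : ℤ) : 𝓞 (IntermediateField.adjoin ℚ {θ})) + ((-1 : ℤ) : 𝓞 (IntermediateField.adjoin ℚ {θ})) * B + ((-1 : ℤ) : 𝓞 (IntermediateField.adjoin ℚ {θ})) * B ^ 2) (((0 : ℤ) : 𝓞 (IntermediateField.adjoin ℚ {θ})) + ((-1 : ℤ) : 𝓞 (IntermediateField.adjoin ℚ {θ})) * B + ((0 : ℤ) : 𝓞 (IntermediateField.adjoin ℚ {θ})) * B ^ 2) (((120 : ℤ) : 𝓞 (IntermediateField.adjoin ℚ {θ})) + ((59 : ℤ) : 𝓞 (IntermediateField.adjoin ℚ {θ})) * B + ((9 : ℤ) : 𝓞 (IntermediateField.adjoin ℚ {θ})) * B ^ 2) (((80640 : ℤ) : 𝓞 (IntermediateField.adjoin ℚ {θ})) + ((29688 : ℤ) : 𝓞 (IntermediateField.adjoin ℚ {θ})) * B + ((5219 : ℤ) : 𝓞 (IntermediateField.adjoin ℚ {θ})) * B ^ 2)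
      (by push_cast; linear_combination (((4 : ℤ) : 𝓞 (IntermediateField.adjoin ℚ {θ})) + ((1 : ℤ) : 𝓞 (IntermediateField.adjoin ℚ {θ})) * B) * hB) (by push_cast; linear_combination (((1224 : ℤ) : 𝓞 (IntermediateField.adjoin ℚ {θ})) + ((81 : ℤ) : 𝓞 (IntermediateField.adjoin ℚ {θ})) * B) * hB) hN
  have h3β : Module.finrank ℚ (IntermediateField.adjoin ℚ {β}) = 3 := by rw [hadj]; exact h3
  exact TotallyComplexMu.conjA_two_cubicModel_of_classicalMu_of_discr_neg (0) (-1046032063923) (411780464906411878)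
    (irreducible_cubic_of_finrank_adjoin_eq_three'' hβ h3β) (by simp only [Cubic.discr]; norm_num) hβ
    (by rw [hadj]; exact fun κL hκL => classicalMuVanishes_of_classGroupPRank_succ_eq' κL (htot κL hκL) le_rfl (h01 κL hκL)) κ hκ

/-- **(A)₂ for `306936ce1` WITHOUT the Lim fact — ONE displayed instrument equality** (Fukuda RANK-FORM row; `2`-torsion cubic field `ℚ(θ)`,
`θ³ + (0)θ² + (-21)θ + (-84) = 0`, `d = -38367 < 0`, EVEN class number). Displayed: `rank₂ Cl(ℚ(θ)·ℚ₁) = rank₂ Cl(ℚ(θ))` along every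
cyclotomic `ℤ₂`-tower (`h01`, census/PARI). KERNEL: total ramification from layer `0` by k4-w1's ODD-DISCRIMINANT door (`2 ∤ d_K` from the index-`2` witness `ω = (θ + θ²)/2`, k4-w1 GEN 6 `…OddDiscriminantDoor`), Fukuda 1994 Thm. 1 (2)
(`classicalMuVanishes_of_classGroupPRank_succ_eq'`, tree `_holds`) ⟹ `μ₂(ℚ(θ)_cyc) = 0` ⟹ cruxlead-19573-w2's `ℓ = 2` ascent to the totally complex `ℚ(E[2])`
and guarded kernel Lim 3.5@2 (`TotallyComplexMu.conjA_two_cubicModel_of_classicalMu_of_discr_neg`, p728213). k4-w1's `conjA_two_306936ce1_of_fukudaLayers`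
proof word for word (adapted copy) with the last step replaced; the binder `hLim2` is GONE. BSD for `306936ce1` is NOT proved by this.
[cite: CoatesSujatha2005, Conj. A and Thm. 3.4] [cite: Fukuda1994, Thm. 1 (2), p. 264] [cite: Iwasawa1973MuInvariants, Thm. 2 and Thm. 3] -/
-- adapted from k4-w1's `conjA_two_306936ce1_of_fukudaLayers` (hLim2 door ↦ Fukuda `_holds` + w2's ascent door)
theorem conjA_two_306936ce1_of_rankEq
    {θ : AlgebraicClosure ℚ} (hθ : aeval θ (Cubic.toPoly ⟨1, ((0 : ℤ) : ℚ), ((-21 : ℤ) : ℚ), ((-84 : ℤ) : ℚ)⟩) = 0)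
    (h01 : haveI : FiniteDimensional ℚ (IntermediateField.adjoin ℚ {θ}) :=
        IntermediateField.adjoin.finiteDimensional ((AlgebraicClosure.isAlgebraic ℚ).isAlgebraic θ).isIntegral
      haveI : NumberField (IntermediateField.adjoin ℚ {θ}) := NumberField.mk
      ∀ κL : ZpExtension (IntermediateField.adjoin ℚ {θ}) 2, κL.IsCyclotomic → classGroupPRank κL 1 = classGroupPRank κL 0)
    (κ : ZpExtension ℚ 2) (hκ : κ.IsCyclotomic) :
    haveI := isElliptic_306936ce1'
    ∃ (γ : absoluteGaloisGroup ℚ) (D : (⟨0, ((0 : ℤ) : ℚ), 0, ((-9901143 : ℤ) : ℚ), ((-11991571830 : ℤ) : ℚ)⟩ : WeierstrassCurve ℚ).FineSelmerDualData κ γ),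
      Module.Finite ℤ_[2] (RestrictScalars ℤ_[2] (IwasawaAlgebra 2) D.X) := by
  haveI := isElliptic_306936ce1'
  have hθ' : θ ^ 3 + (0 : AlgebraicClosure ℚ) * θ ^ 2 + (-21 : AlgebraicClosure ℚ) * θ + (-84 : AlgebraicClosure ℚ) = 0 := by
    have := hθ
    simp only [Cubic.toPoly, map_one, one_mul, aeval_add, aeval_mul, aeval_C, aeval_X_pow, aeval_X,
      eq_ratCast, Rat.cast_intCast] at this
    push_cast at this
    linear_combination this
  set β : AlgebraicClosure ℚ := algebraMap ℚ (AlgebraicClosure ℚ) (-903 : ℚ) +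
      algebraMap ℚ (AlgebraicClosure ℚ) (765 / 2 : ℚ) * θ + algebraMap ℚ (AlgebraicClosure ℚ) (129 / 2 : ℚ) * θ ^ 2 with hβdef
  have hβ : aeval β (Cubic.toPoly ⟨1, ((0 : ℤ) : ℚ), ((-9901143 : ℤ) : ℚ), ((-11991571830 : ℤ) : ℚ)⟩) = 0 := by
    simp only [Cubic.toPoly, map_one, one_mul, aeval_add, aeval_mul, aeval_C, aeval_X_pow, aeval_X, eq_ratCast,
      Rat.cast_intCast]
    rw [hβdef]
    simp only [eq_ratCast]
    push_cast
    linear_combination ((45085167 : AlgebraicClosure ℚ) + ((90700803 : AlgebraicClosure ℚ) / 4) * θ + ((38191095 : AlgebraicClosure ℚ) / 8) * θ ^ 2 + ((2146689 : AlgebraicClosure ℚ) / 8) * θ ^ 3) * hθ'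
  have hadj : IntermediateField.adjoin ℚ {β} = IntermediateField.adjoin ℚ {θ} := by
    apply le_antisymm
    · rw [IntermediateField.adjoin_simple_le_iff, hβdef]
      have hθmem := IntermediateField.mem_adjoin_simple_self ℚ θ
      exact add_mem (add_mem (algebraMap_mem _ _) (mul_mem (algebraMap_mem _ _) hθmem))
        (mul_mem (algebraMap_mem _ _) (pow_mem hθmem 2))
    · rw [IntermediateField.adjoin_simple_le_iff]
      have hθeq : θ = algebraMap ℚ (AlgebraicClosure ℚ) (15768487 / 174 : ℚ) +
          algebraMap ℚ (AlgebraicClosure ℚ) (26041 / 1044 : ℚ) * β +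
          algebraMap ℚ (AlgebraicClosure ℚ) (-43 / 3132 : ℚ) * β ^ 2 := by
        rw [hβdef]; simp only [eq_ratCast]; push_cast
        linear_combination (((157165 : AlgebraicClosure ℚ) / 232) + ((79507 : AlgebraicClosure ℚ) / 1392) * θ) * hθ'
      rw [hθeq]
      have hβmem := IntermediateField.mem_adjoin_simple_self ℚ β
      exact add_mem (add_mem (algebraMap_mem _ _) (mul_mem (algebraMap_mem _ _) hβmem))
        (mul_mem (algebraMap_mem _ _) (pow_mem hβmem 2))
  have hirr := irreducible_cubic_d38367n
  haveI : FiniteDimensional ℚ (IntermediateField.adjoin ℚ {θ}) :=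
    IntermediateField.adjoin.finiteDimensional ((AlgebraicClosure.isAlgebraic ℚ).isAlgebraic θ).isIntegral
  haveI : NumberField (IntermediateField.adjoin ℚ {θ}) := NumberField.mk
  obtain ⟨B, -, hB⟩ := exists_ringOfIntegers_cubic_root (p := 0) (q := -21) (r := -84) hθ
  have h3 := finrank_adjoin_eq_three_of_irreducible hirr hθ
  -- `ω = (θ + θ²)/2 ∈ 𝓞 ℚ(θ)`: `2 ∣ [𝓞 : ℤ[θ]]`, `disc = 4 · (−38367)`, so `2 ∤ d`
  obtain ⟨ω, hω, -⟩ := exists_intElem_of_scaled_cubic _ B 0 1 1 (m := 2) (by norm_num) (-21) 42 (-672)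
    (by push_cast; linear_combination (((64 : ℤ) : 𝓞 (IntermediateField.adjoin ℚ {θ})) + ((-18 : ℤ) : 𝓞 (IntermediateField.adjoin ℚ {θ})) * B + ((3 : ℤ) : 𝓞 (IntermediateField.adjoin ℚ {θ})) * B ^ 2 + ((1 : ℤ) : 𝓞 (IntermediateField.adjoin ℚ {θ})) * B ^ 3) * hB)
  have hodd : ¬ ((2 : ℤ) ∣ NumberField.discr (IntermediateField.adjoin ℚ {θ})) := by
    have := not_dvd_discr_of_intElem _ h3 B hirr hB Nat.prime_two 0 1 1 ⟨ω, hω⟩ (by norm_num)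
      (by simp only [Cubic.discr]; norm_num)
    exact_mod_cast this
  have htot := fun κL hκL => totallyRamifiedFrom_zero_of_not_dvd_discr (by rw [h3]; norm_num) hodd κL hκL
  have h3β : Module.finrank ℚ (IntermediateField.adjoin ℚ {β}) = 3 := by rw [hadj]; exact h3
  exact TotallyComplexMu.conjA_two_cubicModel_of_classicalMu_of_discr_neg (0) (-9901143) (-11991571830)
    (irreducible_cubic_of_finrank_adjoin_eq_three'' hβ h3β) (by simp only [Cubic.discr]; norm_num) hβ
    (by rw [hadj]; exact fun κL hκL => classicalMuVanishes_of_classGroupPRank_succ_eq' κL (htot κL hκL) le_rfl (h01 κL hκL)) κ hκ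

end Summit.BirchSwinnertonDyer.BirchSwinnertonDyer.Theorems.AddKatoTwo

/-! ## §2 The C3″ rungs (namespace `AddPotGoodInstances`) -/

namespace Summit.BirchSwinnertonDyer.BirchSwinnertonDyer.Theorems.AddPotGoodInstances

open WeierstrassCurve Polynomial Literature.NumberTheory.EllipticCurves
  Literature.NumberTheory.IwasawaTheory
  Literature.NumberTheory.EllipticCurves.Rank1Residual
  Literature.NumberTheory.EllipticCurves.Rank1Residual.Typed
  Summit.BirchSwinnertonDyer.Rank1Residual
  Summit.BirchSwinnertonDyer.Rank1Residual.Additive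
  Summit.BirchSwinnertonDyer.BirchSwinnertonDyer.Theorems

/-- Model transport for (A) at `2` in the `∃ γ D` spelling (the statement only depends on the Weierstrass CURVE).
[cite: CoatesSujatha2005, statement (A)] -/
private theorem conjA_two_of_eq {W W' : WeierstrassCurve ℚ} (h : W' = W)
    (H : ∀ (κ : ZpExtension ℚ 2), κ.IsCyclotomic →
      ∃ (γ : Field.absoluteGaloisGroup ℚ) (D : W'.FineSelmerDualData κ γ), Module.Finite ℤ_[2] (RestrictScalars ℤ_[2] (IwasawaAlgebra 2) D.X)) :
    ∀ (κ : ZpExtension ℚ 2), κ.IsCyclotomic →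
      ∃ (γ : Field.absoluteGaloisGroup ℚ) (D : W.FineSelmerDualData κ γ), Module.Finite ℤ_[2] (RestrictScalars ℤ_[2] (IwasawaAlgebra 2) D.X) := by
  subst h; exact H

/-! ## Row `200160bb1` (Δ_cubic < 0, rank form; stamp `AddKatoTwo.conjA_two_200160bb1_of_rankEq` of §1) -/

/-- **(A) at `(200160bb1, 2)` for the Cremona model from ONE displayed rank equality, NO Lim fact**: §1's `AddKatoTwo.conjA_two_200160bb1_of_rankEq`
transported from its cast model `⟨0, ((0 : ℤ) : ℚ), 0, ((-1046032063923 : ℤ) : ℚ), ((411780464906411878 : ℤ) : ℚ)⟩` to the literal model. [cite: CoatesSujatha2005, statement (A)]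
[cite: Fukuda1994, Thm. 1 (2), p. 264] -/
theorem conjA_two_200160bb1_of_rankEq_kernelLit
    {θ : AlgebraicClosure ℚ} (hθ : aeval θ (Cubic.toPoly ⟨1, ((-2 : ℤ) : ℚ), ((-29 : ℤ) : ℚ), ((-120 : ℤ) : ℚ)⟩) = 0)
    (h01 : haveI : FiniteDimensional ℚ (IntermediateField.adjoin ℚ {θ}) :=
        IntermediateField.adjoin.finiteDimensional ((AlgebraicClosure.isAlgebraic ℚ).isAlgebraic θ).isIntegral
      haveI : NumberField (IntermediateField.adjoin ℚ {θ}) := NumberField.mk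
      ∀ κL : ZpExtension (IntermediateField.adjoin ℚ {θ}) 2, κL.IsCyclotomic → classGroupPRank κL 1 = classGroupPRank κL 0)
    :
    haveI := isElliptic_200160bb1
    ∀ (κ : ZpExtension ℚ 2), κ.IsCyclotomic →
      ∃ (γ : Field.absoluteGaloisGroup ℚ) (D : (⟨0, 0, 0, -1046032063923, 411780464906411878⟩ : WeierstrassCurve ℚ).FineSelmerDualData κ γ),
        Module.Finite ℤ_[2] (RestrictScalars ℤ_[2] (IwasawaAlgebra 2) D.X) :=
  conjA_two_of_eq (W' := (⟨0, ((0 : ℤ) : ℚ), 0, ((-1046032063923 : ℤ) : ℚ), ((411780464906411878 : ℤ) : ℚ)⟩ : WeierstrassCurve ℚ)) (by norm_num) (fun κ hκ ↦ AddKatoTwo.conjA_two_200160bb1_of_rankEq hθ h01 κ hκ)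

/-- **`BSD₂(200160bb1)` with (A) from ONE displayed rank equality and NO Lim fact**: GEN 3's rung `bsdp_two_200160bb1_of_conjA` with `hA` supplied by
`conjA_two_200160bb1_of_rankEq_kernelLit hθ h01`. Conditional on PRINT {`hSharp` (reading), `hGZK`, `hmod`, `hCT`}, the RECORD `hr`, `#Ш_an = q` (`ord₂ q ≤ 6`),
the two VALUED slots and the instrument equality `h01` — compared with GEN 8's `bsdp_two_200160bb1_of_lim2_layers` the binder `hLim2` is GONE.
Nothing booked; BSD is not proved by this. [cite: Kato2004Asterisque, Thm. 12.5 (1)(3), 13.8, 14.14] [cite: Fukuda1994, Thm. 1 (2)] [cite: Miller2011LMS, Def. 1.1] -/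
theorem bsdp_two_200160bb1_rankEq
    (hSharp : Kato2004.rankZero_padicValNat_sha_add_padicValNat_tamagawa_le_at_two_of_irreducible_of_fineSelmerDual_fg)
    (hGZK : rank_eq_analyticRank_of_analyticRank_le_one) (hmod : hasEntireLFunction_rat)
    (hCT : exists_casselsTate_pairing (K := ℚ))
    {θ : AlgebraicClosure ℚ} (hθ : aeval θ (Cubic.toPoly ⟨1, ((-2 : ℤ) : ℚ), ((-29 : ℤ) : ℚ), ((-120 : ℤ) : ℚ)⟩) = 0)
    (h01 : haveI : FiniteDimensional ℚ (IntermediateField.adjoin ℚ {θ}) :=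
        IntermediateField.adjoin.finiteDimensional ((AlgebraicClosure.isAlgebraic ℚ).isAlgebraic θ).isIntegral
      haveI : NumberField (IntermediateField.adjoin ℚ {θ}) := NumberField.mk
      ∀ κL : ZpExtension (IntermediateField.adjoin ℚ {θ}) 2, κL.IsCyclotomic → classGroupPRank κL 1 = classGroupPRank κL 0)
    (hr : haveI := isElliptic_200160bb1; (⟨0, 0, 0, -1046032063923, 411780464906411878⟩ : WeierstrassCurve ℚ).analyticRank = 0)
    (hs₁ : Nat.card ((⟨0, 0, 0, -1046032063923, 411780464906411878⟩ : WeierstrassCurve ℚ).selmerGroup (2 ^ 2)) = 2 ^ 4)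
    (hs₂ : Nat.card ((⟨0, 0, 0, -1046032063923, 411780464906411878⟩ : WeierstrassCurve ℚ).selmerGroup (2 ^ (2 + 1))) = 2 ^ 6)
    {q : ℚ} (hq : haveI := isElliptic_200160bb1; shaAn (⟨0, 0, 0, -1046032063923, 411780464906411878⟩ : WeierstrassCurve ℚ) = (q : ℂ)) (hv : padicValRat 2 q ≤ 6) :
    haveI := isElliptic_200160bb1; haveI := isGloballyMinimal_200160bb1
    BSDp (⟨0, 0, 0, -1046032063923, 411780464906411878⟩ : WeierstrassCurve ℚ) 2 := by
  exact bsdp_two_200160bb1_of_conjA hSharp hGZK hmod hCT (conjA_two_200160bb1_of_rankEq_kernelLit hθ h01) hr hs₁ hs₂ hq hv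

/-- **`BSD₂` ON THE WHOLE CLASS of `200160bb1` with (A) from ONE displayed rank equality and NO Lim fact**: GEN 3's class rung
`bsdp_two_of_isIsogenous_200160bb1_of_conjA` (Cassels transport `hCassels`) with `hA` from `conjA_two_200160bb1_of_rankEq_kernelLit hθ h01`; `hLim2` GONE.
Nothing booked; BSD is not proved by this. [cite: Cassels1965ArithmeticVIII, Thm. 1.3] [cite: Kato2004Asterisque, Thm. 12.5 (1)(3)] [cite: Fukuda1994, Thm. 1 (2)] -/
theorem bsdp_two_of_isIsogenous_200160bb1_rankEq
    (hSharp : Kato2004.rankZero_padicValNat_sha_add_padicValNat_tamagawa_le_at_two_of_irreducible_of_fineSelmerDual_fg)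
    (hGZK : rank_eq_analyticRank_of_analyticRank_le_one) (hmod : hasEntireLFunction_rat)
    (hCT : exists_casselsTate_pairing (K := ℚ)) (hCassels : bsdRHS_eq_of_isIsogenous)
    {θ : AlgebraicClosure ℚ} (hθ : aeval θ (Cubic.toPoly ⟨1, ((-2 : ℤ) : ℚ), ((-29 : ℤ) : ℚ), ((-120 : ℤ) : ℚ)⟩) = 0)
    (h01 : haveI : FiniteDimensional ℚ (IntermediateField.adjoin ℚ {θ}) :=
        IntermediateField.adjoin.finiteDimensional ((AlgebraicClosure.isAlgebraic ℚ).isAlgebraic θ).isIntegral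
      haveI : NumberField (IntermediateField.adjoin ℚ {θ}) := NumberField.mk
      ∀ κL : ZpExtension (IntermediateField.adjoin ℚ {θ}) 2, κL.IsCyclotomic → classGroupPRank κL 1 = classGroupPRank κL 0)
    {W : WeierstrassCurve ℚ} [W.IsElliptic] [W.IsGloballyMinimal]
    (hiso : haveI := isElliptic_200160bb1; IsIsogenous W (⟨0, 0, 0, -1046032063923, 411780464906411878⟩ : WeierstrassCurve ℚ)) (hr : W.analyticRank = 0)
    (hs₁ : Nat.card ((⟨0, 0, 0, -1046032063923, 411780464906411878⟩ : WeierstrassCurve ℚ).selmerGroup (2 ^ 2)) = 2 ^ 4)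
    (hs₂ : Nat.card ((⟨0, 0, 0, -1046032063923, 411780464906411878⟩ : WeierstrassCurve ℚ).selmerGroup (2 ^ (2 + 1))) = 2 ^ 6)
    {q : ℚ} (hq : haveI := isElliptic_200160bb1; shaAn (⟨0, 0, 0, -1046032063923, 411780464906411878⟩ : WeierstrassCurve ℚ) = (q : ℂ)) (hv : padicValRat 2 q ≤ 6) :
    BSDp W 2 := by
  exact bsdp_two_of_isIsogenous_200160bb1_of_conjA hSharp hGZK hmod hCT hCassels (conjA_two_200160bb1_of_rankEq_kernelLit hθ h01) hiso hr hs₁ hs₂ hq hv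

/-! ## Row `306936ce1` (Δ_cubic < 0, rank form; stamp `AddKatoTwo.conjA_two_306936ce1_of_rankEq` of §1) -/

/-- **(A) at `(306936ce1, 2)` for the Cremona model from ONE displayed rank equality, NO Lim fact**: §1's `AddKatoTwo.conjA_two_306936ce1_of_rankEq`
transported from its cast model `⟨0, ((0 : ℤ) : ℚ), 0, ((-9901143 : ℤ) : ℚ), ((-11991571830 : ℤ) : ℚ)⟩` to the literal model. [cite: CoatesSujatha2005, statement (A)]
[cite: Fukuda1994, Thm. 1 (2), p. 264] -/
theorem conjA_two_306936ce1_of_rankEq_kernelLit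
    {θ : AlgebraicClosure ℚ} (hθ : aeval θ (Cubic.toPoly ⟨1, ((0 : ℤ) : ℚ), ((-21 : ℤ) : ℚ), ((-84 : ℤ) : ℚ)⟩) = 0)
    (h01 : haveI : FiniteDimensional ℚ (IntermediateField.adjoin ℚ {θ}) :=
        IntermediateField.adjoin.finiteDimensional ((AlgebraicClosure.isAlgebraic ℚ).isAlgebraic θ).isIntegral
      haveI : NumberField (IntermediateField.adjoin ℚ {θ}) := NumberField.mk
      ∀ κL : ZpExtension (IntermediateField.adjoin ℚ {θ}) 2, κL.IsCyclotomic → classGroupPRank κL 1 = classGroupPRank κL 0)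
    :
    haveI := isElliptic_306936ce1
    ∀ (κ : ZpExtension ℚ 2), κ.IsCyclotomic →
      ∃ (γ : Field.absoluteGaloisGroup ℚ) (D : (⟨0, 0, 0, -9901143, -11991571830⟩ : WeierstrassCurve ℚ).FineSelmerDualData κ γ),
        Module.Finite ℤ_[2] (RestrictScalars ℤ_[2] (IwasawaAlgebra 2) D.X) :=
  conjA_two_of_eq (W' := (⟨0, ((0 : ℤ) : ℚ), 0, ((-9901143 : ℤ) : ℚ), ((-11991571830 : ℤ) : ℚ)⟩ : WeierstrassCurve ℚ)) (by norm_num) (fun κ hκ ↦ AddKatoTwo.conjA_two_306936ce1_of_rankEq hθ h01 κ hκ)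

/-- **`BSD₂(306936ce1)` with (A) from ONE displayed rank equality and NO Lim fact**: GEN 3's rung `bsdp_two_306936ce1_of_conjA` with `hA` supplied by
`conjA_two_306936ce1_of_rankEq_kernelLit hθ h01`. Conditional on PRINT {`hSharp` (reading), `hGZK`, `hmod`, `hCT`}, the RECORD `hr`, `#Ш_an = q` (`ord₂ q ≤ 6`),
the two VALUED slots and the instrument equality `h01` — compared with GEN 8's `bsdp_two_306936ce1_of_lim2_layers` the binder `hLim2` is GONE.
Nothing booked; BSD is not proved by this. [cite: Kato2004Asterisque, Thm. 12.5 (1)(3), 13.8, 14.14] [cite: Fukuda1994, Thm. 1 (2)] [cite: Miller2011LMS, Def. 1.1] -/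
theorem bsdp_two_306936ce1_rankEq
    (hSharp : Kato2004.rankZero_padicValNat_sha_add_padicValNat_tamagawa_le_at_two_of_irreducible_of_fineSelmerDual_fg)
    (hGZK : rank_eq_analyticRank_of_analyticRank_le_one) (hmod : hasEntireLFunction_rat)
    (hCT : exists_casselsTate_pairing (K := ℚ))
    {θ : AlgebraicClosure ℚ} (hθ : aeval θ (Cubic.toPoly ⟨1, ((0 : ℤ) : ℚ), ((-21 : ℤ) : ℚ), ((-84 : ℤ) : ℚ)⟩) = 0)
    (h01 : haveI : FiniteDimensional ℚ (IntermediateField.adjoin ℚ {θ}) :=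
        IntermediateField.adjoin.finiteDimensional ((AlgebraicClosure.isAlgebraic ℚ).isAlgebraic θ).isIntegral
      haveI : NumberField (IntermediateField.adjoin ℚ {θ}) := NumberField.mk
      ∀ κL : ZpExtension (IntermediateField.adjoin ℚ {θ}) 2, κL.IsCyclotomic → classGroupPRank κL 1 = classGroupPRank κL 0)
    (hr : haveI := isElliptic_306936ce1; (⟨0, 0, 0, -9901143, -11991571830⟩ : WeierstrassCurve ℚ).analyticRank = 0)
    (hs₁ : Nat.card ((⟨0, 0, 0, -9901143, -11991571830⟩ : WeierstrassCurve ℚ).selmerGroup (2 ^ 2)) = 2 ^ 4)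
    (hs₂ : Nat.card ((⟨0, 0, 0, -9901143, -11991571830⟩ : WeierstrassCurve ℚ).selmerGroup (2 ^ (2 + 1))) = 2 ^ 6)
    {q : ℚ} (hq : haveI := isElliptic_306936ce1; shaAn (⟨0, 0, 0, -9901143, -11991571830⟩ : WeierstrassCurve ℚ) = (q : ℂ)) (hv : padicValRat 2 q ≤ 6) :
    haveI := isElliptic_306936ce1; haveI := isGloballyMinimal_306936ce1
    BSDp (⟨0, 0, 0, -9901143, -11991571830⟩ : WeierstrassCurve ℚ) 2 := by
  exact bsdp_two_306936ce1_of_conjA hSharp hGZK hmod hCT (conjA_two_306936ce1_of_rankEq_kernelLit hθ h01) hr hs₁ hs₂ hq hv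

/-- **`BSD₂` ON THE WHOLE CLASS of `306936ce1` with (A) from ONE displayed rank equality and NO Lim fact**: GEN 3's class rung
`bsdp_two_of_isIsogenous_306936ce1_of_conjA` (Cassels transport `hCassels`) with `hA` from `conjA_two_306936ce1_of_rankEq_kernelLit hθ h01`; `hLim2` GONE.
Nothing booked; BSD is not proved by this. [cite: Cassels1965ArithmeticVIII, Thm. 1.3] [cite: Kato2004Asterisque, Thm. 12.5 (1)(3)] [cite: Fukuda1994, Thm. 1 (2)] -/
theorem bsdp_two_of_isIsogenous_306936ce1_rankEq
    (hSharp : Kato2004.rankZero_padicValNat_sha_add_padicValNat_tamagawa_le_at_two_of_irreducible_of_fineSelmerDual_fg)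
    (hGZK : rank_eq_analyticRank_of_analyticRank_le_one) (hmod : hasEntireLFunction_rat)
    (hCT : exists_casselsTate_pairing (K := ℚ)) (hCassels : bsdRHS_eq_of_isIsogenous)
    {θ : AlgebraicClosure ℚ} (hθ : aeval θ (Cubic.toPoly ⟨1, ((0 : ℤ) : ℚ), ((-21 : ℤ) : ℚ), ((-84 : ℤ) : ℚ)⟩) = 0)
    (h01 : haveI : FiniteDimensional ℚ (IntermediateField.adjoin ℚ {θ}) :=
        IntermediateField.adjoin.finiteDimensional ((AlgebraicClosure.isAlgebraic ℚ).isAlgebraic θ).isIntegral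
      haveI : NumberField (IntermediateField.adjoin ℚ {θ}) := NumberField.mk
      ∀ κL : ZpExtension (IntermediateField.adjoin ℚ {θ}) 2, κL.IsCyclotomic → classGroupPRank κL 1 = classGroupPRank κL 0)
    {W : WeierstrassCurve ℚ} [W.IsElliptic] [W.IsGloballyMinimal]
    (hiso : haveI := isElliptic_306936ce1; IsIsogenous W (⟨0, 0, 0, -9901143, -11991571830⟩ : WeierstrassCurve ℚ)) (hr : W.analyticRank = 0)
    (hs₁ : Nat.card ((⟨0, 0, 0, -9901143, -11991571830⟩ : WeierstrassCurve ℚ).selmerGroup (2 ^ 2)) = 2 ^ 4)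
    (hs₂ : Nat.card ((⟨0, 0, 0, -9901143, -11991571830⟩ : WeierstrassCurve ℚ).selmerGroup (2 ^ (2 + 1))) = 2 ^ 6)
    {q : ℚ} (hq : haveI := isElliptic_306936ce1; shaAn (⟨0, 0, 0, -9901143, -11991571830⟩ : WeierstrassCurve ℚ) = (q : ℂ)) (hv : padicValRat 2 q ≤ 6) :
    BSDp W 2 := by
  exact bsdp_two_of_isIsogenous_306936ce1_of_conjA hSharp hGZK hmod hCT hCassels (conjA_two_306936ce1_of_rankEq_kernelLit hθ h01) hiso hr hs₁ hs₂ hq hv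

end Summit.BirchSwinnertonDyer.BirchSwinnertonDyer.Theorems.AddPotGoodInstances

end
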